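import Summits.QuantumFields.YangMills.Theorems.PoincareLipschitzSphereMapDepthRadius

/-!
# Line «poincare_lipschitz» on crux `HistoryTailL` (stmt-QuantumFields-19936), route crux `BlockLipschitzL` (stmt-QuantumFields-23533), K2 organ of record LOC-REG-MIN —
# FLAT SHADOW «ENERGY → RANGE» (E→R) FOR LATTICE MINIMISERS INTO A SPHERE, FILE 5d-D: THE TENT RADIUS AND ITS SUPPORT —
# `Σ(y) = ⌊min(r′ − ‖y−z‖_∞, ‖y−z‖_∞ − R_in)₊ ∕ 4⌋`: bond-Lipschitz, comparable (`A = 2, B = 3`), vanishing off the band `R_in + 4 ≤ ‖y−z‖_∞ ≤ r′ − 4`, where it vanishes the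
# mollifier IS `u`, the boxes `Q_{Σ(y)+2}(y)` of band points stay in `Q_{r′−1}(z) ∖ Q_{R_in}(z)`, and the generic split `E(c − u; Q) ≤ 2E(c; T) + 2E(u; T)`

Cell `ym3-torus` (YM ladder rung R3 = continuum SU(2) Yang–Mills on the three-torus — a RUNG, NOT the Clay problem: not d = 4, not infinite volume, not a mass gap); width seat
`ym-ust-19936-w5` gen 12 (LEAD ym-ust-19936-w1 g8 2026-08-29T05:29:02Z END-GAME «[C] = E→R F5 (★w5) + F6 (px8)»; my LOCATE `E2R-ROAD-w5g12.md` §2 (ii)(vi)).  THEOREMS ONLY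
(def-free; `‖y − z‖_∞ = Finset.univ.sup (fun j => (y j − z j).natAbs)` and the tent radius written in place; `θ = ¼` as the literal `∕ 4`), lattice letters of lit
✓`B4Eq19LatticeOperators`; builds on ★w5 g12's ✓`PoincareLipschitzSphereMapDepthRadius` (sup-distance letters; the OUTER half of the tent is that file's σ);
`--supports stmt-QuantumFields-19936`.  Nothing here proves E→R, LOC-REG-MIN, `hReg`, `hImprove`, a stub, `BlockLipschitzL`, `HistoryTailL` or a summit statement.

WHY THE TENT (`E2R-ROAD-w5g12.md` §2 (vi), ✓`minimality_split` ∕ ✓`interior_comparison`): the competitor is `π∘H`, `H` the harmonic extension into `Q_{R−1}(z)` of the mollified field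
`c = ū_Σ`; the Dirichlet-principle competitor is `h′ + (c − u)`, so `c − u` must ALSO die inside `Q_R` — the radius grows from `0` at depth `4` below `r′` to `⌊ℓ∕4⌋` on the ring
`‖y−z‖_∞ = R = r′ − ℓ` and shrinks back to `0` at `‖y−z‖_∞ = R_in + 4`, `R_in = 2R − r′`: one bond-Lipschitz, comparable radius for F4 ✓`energy_mollifier_le` on BOTH sides.
* §1 `tentRadius_nonneg`, ★ `abs_tentRadius_sub_le_one` (bond-Lipschitz, `d ≥ 1`), ★★ `tentRadius_comparable` (LEAD's `hcomp`, `A = 2`, `B = 3`), ★ `tentRadius_eq_zero_of_le` ∕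
  `tentRadius_eq_zero_of_ge` (vanishing off the band), `tentRadius_pos_band` (`Σ(y) ≠ 0 ⇒ R_in + 4 ≤ ‖y−z‖_∞ ≤ r′ − 4`), `tentRadius_ring`
  (`‖y−z‖_∞ = R`, `R_in = 2R − r′` ⇒ `Σ(y) = ⌊(r′ − R)₊∕4⌋`);
* §2 ★ `mean_eq_self_of_radius_eq_zero` (radius `0` ⇒ the mollifier IS `u`), ★ `box_tent_subset_band` (`R_in + 3 ≤ ‖y−z‖_∞ ≤ r′ − 3` ⇒
  `Q_{Σ(y)+2}(y) ⊆ Q_{r′−1}(z) ∖ Q_{R_in}(z)` — the `U` of F4);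
* §3 ★★ `energy_sub_le_on_support` — GENERIC: `E(c − u; Q) ≤ 2·E(c; T) + 2·E(u; T)` for every `T ⊇ {y ∈ Q : c y ≠ u y ∨ ∃ μ, c(y+e_μ) ≠ u(y+e_μ)}` — the `X`-slot of
  ✓`interior_comparison` lives on the inner tent only.
[folklore] ([SchoenUhlenbeck1982] §4; the lattice statements are this file's).
-/

set_option autoImplicit false

noncomputable section

open scoped BigOperators
open Finset

namespace Summit.QuantumFields.YangMills.Theorems.PoincareLipschitzSphereMapTentSupport

open Literature.MathematicalPhysics.QuantumFieldTheory.Balaban1983to89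
open B4Eq19LatticeOperators
open Summit.QuantumFields.YangMills.Theorems.PoincareLipschitzSphereMapDepthRadius
  (abs_sup_sub_sup_le_of_mem_box mem_box_add_of_mem_mem mem_box_iff_sup_le sup_le_sup_add_of_mem_box mean_box_zero)

variable {d : ℕ}

/-! ## §1 The tent radius -/

/-- `Σ ≥ 0`. [folklore] -/
theorem tentRadius_nonneg (z : Zd d) (r' Rin : ℤ) (y : Zd d) :
    (0 : ℤ) ≤ (((min (r' - ((Finset.univ.sup fun j => (y j - z j).natAbs : ℕ) : ℤ)) (((Finset.univ.sup fun j => (y j - z j).natAbs : ℕ) : ℤ) - Rin)).toNat / 4 : ℕ) : ℤ) := by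
  exact_mod_cast Nat.zero_le _

/-- ★ **BOND-LIPSCHITZ** (`d ≥ 1`): `|Σ(y + e_μ) − Σ(y)| ≤ 1`. [folklore] -/
theorem abs_tentRadius_sub_le_one (hd : 0 < d) (z : Zd d) (r' Rin : ℤ) (y : Zd d) (μ : Fin d) :
    |(((min (r' - ((Finset.univ.sup fun j => ((y + unitVec μ) j - z j).natAbs : ℕ) : ℤ)) (((Finset.univ.sup fun j => ((y + unitVec μ) j - z j).natAbs : ℕ) : ℤ) - Rin)).toNat / 4 : ℕ) : ℤ) -
      (((min (r' - ((Finset.univ.sup fun j => (y j - z j).natAbs : ℕ) : ℤ)) (((Finset.univ.sup fun j => (y j - z j).natAbs : ℕ) : ℤ) - Rin)).toNat / 4 : ℕ) : ℤ)| ≤ 1 := by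
  have hmem : y + unitVec μ ∈ box y 1 := by
    have := add_unitVec_mem_box (self_mem_box y le_rfl) μ
    simpa using this
  have h := abs_sup_sub_sup_le_of_mem_box hd z hmem
  set a : ℤ := ((Finset.univ.sup fun j => (y j - z j).natAbs : ℕ) : ℤ)
  set b : ℤ := ((Finset.univ.sup fun j => ((y + unitVec μ) j - z j).natAbs : ℕ) : ℤ)
  rw [abs_le] at h ⊢
  constructor <;> omega

/-- ★★ **LEAD's COMPARABILITY with `A = 2`, `B = 3`** for the tent radius (`d ≥ 1`). [folklore] [cite: SchoenUhlenbeck1982, §4] -/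
theorem tentRadius_comparable (hd : 0 < d) (z : Zd d) (r' Rin : ℤ) (x x' y : Zd d)
    (hy : y ∈ box x ((((min (r' - ((Finset.univ.sup fun j => (x j - z j).natAbs : ℕ) : ℤ)) (((Finset.univ.sup fun j => (x j - z j).natAbs : ℕ) : ℤ) - Rin)).toNat / 4 : ℕ) : ℤ) + 2))
    (hy' : y ∈ box x' ((((min (r' - ((Finset.univ.sup fun j => (x' j - z j).natAbs : ℕ) : ℤ)) (((Finset.univ.sup fun j => (x' j - z j).natAbs : ℕ) : ℤ) - Rin)).toNat / 4 : ℕ) : ℤ) + 2)) :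
    (((min (r' - ((Finset.univ.sup fun j => (x j - z j).natAbs : ℕ) : ℤ)) (((Finset.univ.sup fun j => (x j - z j).natAbs : ℕ) : ℤ) - Rin)).toNat / 4 : ℕ) : ℤ) ≤
      (2 : ℤ) * (((min (r' - ((Finset.univ.sup fun j => (x' j - z j).natAbs : ℕ) : ℤ)) (((Finset.univ.sup fun j => (x' j - z j).natAbs : ℕ) : ℤ) - Rin)).toNat / 4 : ℕ) : ℤ) + (3 : ℕ) := by
  have hxx' := mem_box_add_of_mem_mem hy hy'
  have h := abs_sup_sub_sup_le_of_mem_box hd z hxx'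
  set a : ℤ := ((Finset.univ.sup fun j => (x j - z j).natAbs : ℕ) : ℤ)
  set a' : ℤ := ((Finset.univ.sup fun j => (x' j - z j).natAbs : ℕ) : ℤ)
  rw [abs_le] at h
  push_cast
  omega

/-- Vanishing near the outer boundary: `‖y − z‖_∞ ≥ r′ − 3` ⟹ `Σ(y) = 0`. [folklore] -/
theorem tentRadius_eq_zero_of_ge (z : Zd d) (r' Rin : ℤ) (y : Zd d) (hy : r' - 3 ≤ ((Finset.univ.sup fun j => (y j - z j).natAbs : ℕ) : ℤ)) :
    (((min (r' - ((Finset.univ.sup fun j => (y j - z j).natAbs : ℕ) : ℤ)) (((Finset.univ.sup fun j => (y j - z j).natAbs : ℕ) : ℤ) - Rin)).toNat / 4 : ℕ) : ℤ) = 0 := by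
  have : ((min (r' - ((Finset.univ.sup fun j => (y j - z j).natAbs : ℕ) : ℤ)) (((Finset.univ.sup fun j => (y j - z j).natAbs : ℕ) : ℤ) - Rin)).toNat / 4 : ℕ) = 0 := by
    apply Nat.div_eq_of_lt; omega
  rw [this]; rfl

/-- Vanishing near the inner boundary: `‖y − z‖_∞ ≤ R_in + 3` ⟹ `Σ(y) = 0`. [folklore] -/
theorem tentRadius_eq_zero_of_le (z : Zd d) (r' Rin : ℤ) (y : Zd d) (hy : ((Finset.univ.sup fun j => (y j - z j).natAbs : ℕ) : ℤ) ≤ Rin + 3) :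
    (((min (r' - ((Finset.univ.sup fun j => (y j - z j).natAbs : ℕ) : ℤ)) (((Finset.univ.sup fun j => (y j - z j).natAbs : ℕ) : ℤ) - Rin)).toNat / 4 : ℕ) : ℤ) = 0 := by
  have : ((min (r' - ((Finset.univ.sup fun j => (y j - z j).natAbs : ℕ) : ℤ)) (((Finset.univ.sup fun j => (y j - z j).natAbs : ℕ) : ℤ) - Rin)).toNat / 4 : ℕ) = 0 := by
    apply Nat.div_eq_of_lt; omega
  rw [this]; rfl

/-- The band where the radius is positive: `Σ(y) ≠ 0` ⟹ `R_in + 4 ≤ ‖y − z‖_∞ ≤ r′ − 4`. [folklore] -/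
theorem tentRadius_pos_band (z : Zd d) (r' Rin : ℤ) (y : Zd d)
    (h : (((min (r' - ((Finset.univ.sup fun j => (y j - z j).natAbs : ℕ) : ℤ)) (((Finset.univ.sup fun j => (y j - z j).natAbs : ℕ) : ℤ) - Rin)).toNat / 4 : ℕ) : ℤ) ≠ 0) :
    Rin + 4 ≤ ((Finset.univ.sup fun j => (y j - z j).natAbs : ℕ) : ℤ) ∧ ((Finset.univ.sup fun j => (y j - z j).natAbs : ℕ) : ℤ) ≤ r' - 4 := by
  constructor
  · by_contra hc; push Not at hc
    exact h (tentRadius_eq_zero_of_le z r' Rin y (by omega))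
  · by_contra hc; push Not at hc
    exact h (tentRadius_eq_zero_of_ge z r' Rin y (by omega))

/-- On the ring `‖y − z‖_∞ = R` with `R_in = 2R − r′` both slopes of the tent agree: `Σ(y) = ⌊(r′ − R)₊ ∕ 4⌋`. [folklore] -/
theorem tentRadius_ring (z : Zd d) (r' R : ℤ) (y : Zd d) (hy : ((Finset.univ.sup fun j => (y j - z j).natAbs : ℕ) : ℤ) = R) :
    (((min (r' - ((Finset.univ.sup fun j => (y j - z j).natAbs : ℕ) : ℤ)) (((Finset.univ.sup fun j => (y j - z j).natAbs : ℕ) : ℤ) - (2 * R - r'))).toNat / 4 : ℕ) : ℤ) =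
      (((r' - R).toNat / 4 : ℕ) : ℤ) := by
  rw [hy, show R - (2 * R - r') = r' - R by ring, min_self]

/-! ## §2 Radius zero is the field itself; tent boxes stay in the band -/

/-- ★ **RADIUS ZERO: THE MOLLIFIER IS `u`** — if the radius expression `ρ` vanishes at `y` then `(#Q_ρ(y))⁻¹ • Σ_{Q_ρ(y)} u = u y`. [folklore] -/
theorem mean_eq_self_of_radius_eq_zero {V : Type*} [AddCommGroup V] [Module ℝ V] (u : Zd d → V) (y : Zd d) {ρ : ℤ} (hρ : ρ = 0) :
    (((box y ρ).card : ℝ))⁻¹ • ∑ w ∈ box y ρ, u w = u y := by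
  rw [hρ]; exact mean_box_zero u y

/-- ★ **TENT BOXES STAY IN THE BAND**: `d ≥ 1`, `R_in + 3 ≤ ‖y − z‖_∞ ≤ r′ − 3` ⟹ `Q_{Σ(y)+2}(y) ⊆ Q_{r′−1}(z)` and `Q_{Σ(y)+2}(y) ∩ Q_{R_in}(z) = ∅` (as `y′ ∉ Q_{R_in}(z)` for
`y′` in the tent box) — the `U = Q_{r′−1}(z) ∖ Q_{R_in}(z)` of ✓`energy_mollifier_le`. [folklore] -/
theorem box_tent_subset_band (hd : 0 < d) (z : Zd d) (r' Rin : ℤ) (y : Zd d)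
    (hlo : Rin + 3 ≤ ((Finset.univ.sup fun j => (y j - z j).natAbs : ℕ) : ℤ)) (hhi : ((Finset.univ.sup fun j => (y j - z j).natAbs : ℕ) : ℤ) ≤ r' - 3) :
    box y ((((min (r' - ((Finset.univ.sup fun j => (y j - z j).natAbs : ℕ) : ℤ)) (((Finset.univ.sup fun j => (y j - z j).natAbs : ℕ) : ℤ) - Rin)).toNat / 4 : ℕ) : ℤ) + 2) ⊆
      box z (r' - 1) \ box z Rin := by
  intro y' hy'
  have h := abs_sup_sub_sup_le_of_mem_box hd z hy'
  set a : ℤ := ((Finset.univ.sup fun j => (y j - z j).natAbs : ℕ) : ℤ) with ha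
  set a' : ℤ := ((Finset.univ.sup fun j => (y' j - z j).natAbs : ℕ) : ℤ) with ha'
  rw [abs_le] at h
  rw [Finset.mem_sdiff, mem_box_iff_sup_le hd, mem_box_iff_sup_le hd, ← ha']
  push_cast at h
  constructor <;> omega

/-! ## §3 The `X`-slot lives where the mollifier differs from `u` -/

/-- ★★ **GENERIC SUPPORT SPLIT**: for fields `c, u : ℤ^d → V`, a finite `Q`, and any `T` with
`{y ∈ Q : c y ≠ u y ∨ ∃ μ, c(y+e_μ) ≠ u(y+e_μ)} ⊆ T`: `E(c − u; Q) ≤ 2·E(c; T) + 2·E(u; T)` (`E(f;S) = Σ_{y∈S}Σ_μ‖f(y+e_μ) − f y‖²`). [folklore] -/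
theorem energy_sub_le_on_support {V : Type*} [NormedAddCommGroup V] (c u : Zd d → V) (Q T : Finset (Zd d))
    (hT : ∀ y ∈ Q, (c y ≠ u y ∨ ∃ μ : Fin d, c (y + unitVec μ) ≠ u (y + unitVec μ)) → y ∈ T) :
    ∑ y ∈ Q, ∑ μ, ‖(c (y + unitVec μ) - u (y + unitVec μ)) - (c y - u y)‖ ^ 2 ≤
      2 * ∑ y ∈ T, ∑ μ, ‖c (y + unitVec μ) - c y‖ ^ 2 + 2 * ∑ y ∈ T, ∑ μ, ‖u (y + unitVec μ) - u y‖ ^ 2 := by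
  classical
  -- the summand vanishes off `T`
  have hzero : ∀ y ∈ Q, y ∉ T → ∑ μ : Fin d, ‖(c (y + unitVec μ) - u (y + unitVec μ)) - (c y - u y)‖ ^ 2 = 0 := by
    intro y hy hyT
    have hc : ¬ (c y ≠ u y ∨ ∃ μ : Fin d, c (y + unitVec μ) ≠ u (y + unitVec μ)) := fun h => hyT (hT y hy h)
    push Not at hc
    refine Finset.sum_eq_zero fun μ _ => ?_
    rw [hc.1, hc.2 μ]; simp
  -- restrict to `Q ∩ T`, then enlarge to `T`
  have h1 : ∑ y ∈ Q, ∑ μ, ‖(c (y + unitVec μ) - u (y + unitVec μ)) - (c y - u y)‖ ^ 2 =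
      ∑ y ∈ Q.filter (fun y => y ∈ T), ∑ μ, ‖(c (y + unitVec μ) - u (y + unitVec μ)) - (c y - u y)‖ ^ 2 := by
    rw [← Finset.sum_filter_add_sum_filter_not Q (fun y => y ∈ T)]
    have : ∑ y ∈ Q.filter (fun y => ¬ y ∈ T), ∑ μ : Fin d, ‖(c (y + unitVec μ) - u (y + unitVec μ)) - (c y - u y)‖ ^ 2 = 0 :=
      Finset.sum_eq_zero fun y hy => by rw [Finset.mem_filter] at hy; exact hzero y hy.1 hy.2
    rw [this, add_zero]
  have hsub : Q.filter (fun y => y ∈ T) ⊆ T := fun y hy => (Finset.mem_filter.1 hy).2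
  have h2 : ∀ y, ∑ μ : Fin d, ‖(c (y + unitVec μ) - u (y + unitVec μ)) - (c y - u y)‖ ^ 2 ≤
      2 * ∑ μ : Fin d, ‖c (y + unitVec μ) - c y‖ ^ 2 + 2 * ∑ μ : Fin d, ‖u (y + unitVec μ) - u y‖ ^ 2 := by
    intro y
    rw [Finset.mul_sum, Finset.mul_sum, ← Finset.sum_add_distrib]
    refine Finset.sum_le_sum fun μ _ => ?_
    have e : (c (y + unitVec μ) - u (y + unitVec μ)) - (c y - u y) = (c (y + unitVec μ) - c y) - (u (y + unitVec μ) - u y) := by abel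
    rw [e]
    have h := norm_sub_le (c (y + unitVec μ) - c y) (u (y + unitVec μ) - u y)
    have h0 : 0 ≤ ‖(c (y + unitVec μ) - c y) - (u (y + unitVec μ) - u y)‖ := norm_nonneg _
    nlinarith [norm_nonneg (c (y + unitVec μ) - c y), norm_nonneg (u (y + unitVec μ) - u y),
      sq_nonneg (‖c (y + unitVec μ) - c y‖ - ‖u (y + unitVec μ) - u y‖)]
  rw [h1]
  calc ∑ y ∈ Q.filter (fun y => y ∈ T), ∑ μ, ‖(c (y + unitVec μ) - u (y + unitVec μ)) - (c y - u y)‖ ^ 2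
      ≤ ∑ y ∈ T, ∑ μ, ‖(c (y + unitVec μ) - u (y + unitVec μ)) - (c y - u y)‖ ^ 2 :=
        Finset.sum_le_sum_of_subset_of_nonneg hsub fun _ _ _ => Finset.sum_nonneg fun _ _ => by positivity
    _ ≤ ∑ y ∈ T, (2 * ∑ μ : Fin d, ‖c (y + unitVec μ) - c y‖ ^ 2 + 2 * ∑ μ : Fin d, ‖u (y + unitVec μ) - u y‖ ^ 2) := Finset.sum_le_sum fun y _ => h2 y
    _ = _ := by rw [Finset.sum_add_distrib, ← Finset.mul_sum, ← Finset.mul_sum]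

end Summit.QuantumFields.YangMills.Theorems.PoincareLipschitzSphereMapTentSupport
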